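import Summits.PneNP.PneNP.Theorems.ChebyshevTracialDesignBulkNumerics
import HarnessLib

/-!
# Cell pnp-psdrank, route `ChebyshevTracialDesign`: Lq's two constants `Γ(N′)`, `q(N′)` in the `P = N₀^{1/8}` scale, for EVERY edge number
# `N′` of the pinned families (crux `TracialDecayExp20`, stmt-PneNP-19878)

Brick 140a (eng g26; numerics scaffolding for the γ-direction assembly, MEMO-30 §3b/§4 «126b-type numerics»). The tree's pointwise relative
level-smoothness theorem `ShellStep.abs_fwdDiff_iter_shellLaw_le_of_hyps` (Lq) bounds `c_k|Δ^k law|` by `Γ·q^k·law₁ + (4/3)^k e^{−(L−2D)²/(4N)}` with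
`η = 8(L+D+1)/((β²/8)⁴β(N−2D))`, `Q = 2√192·√(2(2D+1)(1+η)/((β²/8)⁴β(N−2D)))`, `Γ = 1 + (4(√N+1)/3)·Q`, `q = 4((1+η)(η+Q))²/(3β)`.
Brick 124a part 2 (`bulk_numerics`) bounds them at `N = N₀` INSIDE its proof; the γ-direction inputs (ii)/(iii) (bricks 135–139) use Lq on THREE
edge numbers `N₀, N₀−1, N₀−2` (pinned families), and their `ε_A, ε_B, ε_C` are polynomials in `Γ(N′), q(N′)`. This file exports the bounds once,
for a FREE scale `P ≥ 1` and ANY real `N′` with `P⁸/4 ≤ N′ − 2D`, `N′ ≤ P⁸` (so `N₀ = P⁸` and its two predecessors qualify as soon as `8D + 8 ≤ 3P⁸`):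
* `lqConstants_le`: with `D ≤ 2P²`, `L + D + 1 ≤ c_L·P⁵`, `c_η := 32c_L/((β²/8)⁴β) ≤ P³`:
  `η(N′) ≤ c_η/P³ (≤ 1)`, `Q(N′) ≤ c_Q/P³` with `c_Q = 2√192·√(80/((β²/8)⁴β))`, `1 ≤ Γ(N′) ≤ (1 + 8c_Q/3)·P`, `0 ≤ q(N′) ≤ (16(c_η+c_Q)²/(3β))/P⁶`;
* `Gamma_mul_q_le`: hence `Γ(N′)·q(N′) ≤ (1 + 8c_Q/3)(16(c_η+c_Q)²/(3β))/P⁵` — the main terms of `ε_B` (brick 137: `m·Γq/√cV`, `m ≤ N₀ = P⁸`,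
  `√cV ≍ P⁴`) and `ε_C` (`2Γq`) are `O(P⁻¹)`, `O(P⁻⁵)`;
* `exp_far_mono`: the far term is monotone in the edge number, `e^{−(L−2D)²/(4N′)} ≤ e^{−(L−2D)²/(4N)}` for `0 < N′ ≤ N`.
Pure real arithmetic; nothing combinatorial. WHAT THIS FILE DOES NOT DO: choose `L, R, ε` (brick 124a's `E, R, L` bookkeeping stands), prove `ε_A + ε_B ≤ 1`
(needs brick 139's shape), anything on `TracialDecayExp20` itself, psd rank of P_PM(K_n), or P vs NP.
[cite: RollinRoss2010, §4.1 Thm 4.2 (the variance scale)] [cite: Agarwal2000DifferenceEquations, Remark 1.8.1]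
Stature: support/instrument (kernel lane, no defs, axioms standard). Supports stmt-PneNP-19878.
-/

set_option linter.dupNamespace false -- `Summit.PneNP.PneNP.…`: summit = sub-problem (D-0017)

noncomputable section

namespace Summit.PneNP.PneNP.Theorems.ChebyshevTracialDesignLqConstantsScale

open Real

/-- **Lq's constants in the `P`-scale, any admissible edge number.** For `0 < β`, `1 ≤ P`, `0 ≤ D ≤ 2P²`, `L + D + 1 ≤ c_L P⁵` (`c_L ≥ 0`),
`0 ≤ L`, `P⁸/4 ≤ N′ − 2D`, `N′ ≤ P⁸` and `c_η = 32c_L/((β²/8)⁴β) ≤ P³`: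
`η(N′) ≤ c_η/P³`, `Q(N′) ≤ c_Q/P³`, `1 ≤ Γ(N′) ≤ (1 + 8c_Q/3)P`, `0 ≤ q(N′) ≤ (16(c_η + c_Q)²/(3β))/P⁶`
(`c_Q = 2√192·√(80/((β²/8)⁴β))`; the expressions are those of `ShellStep.abs_fwdDiff_iter_shellLaw_le_of_hyps`, verbatim in `N′, D, L, β`).
[cite: RollinRoss2010, §4.1 Thm 4.2 (the variance scale)] -/
theorem lqConstants_le {β P D L N' cL : ℝ} (hβ : 0 < β) (hP1 : 1 ≤ P) (hD0 : 0 ≤ D) (hD : D ≤ 2 * P ^ 2)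
    (hL0 : 0 ≤ L) (hcL : 0 ≤ cL) (hLD1 : L + D + 1 ≤ cL * P ^ 5) (hN'lo : P ^ 8 / 4 ≤ N' - 2 * D) (hN'hi : N' ≤ P ^ 8)
    (hPη : 32 * cL / ((β ^ 2 / 8) ^ 4 * β) ≤ P ^ 3) :
    8 * (L + D + 1) / ((β ^ 2 / 8) ^ 4 * (β * (N' - 2 * D))) ≤ 32 * cL / ((β ^ 2 / 8) ^ 4 * β) / P ^ 3 ∧
    2 * Real.sqrt 192 * Real.sqrt (2 * (2 * D + 1) * (1 + 8 * (L + D + 1) / ((β ^ 2 / 8) ^ 4 * (β * (N' - 2 * D)))) /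
        ((β ^ 2 / 8) ^ 4 * (β * (N' - 2 * D)))) ≤ 2 * Real.sqrt 192 * Real.sqrt (80 / ((β ^ 2 / 8) ^ 4 * β)) / P ^ 3 ∧
    1 ≤ 1 + 4 * (Real.sqrt N' + 1) / 3 *
          (2 * Real.sqrt 192 * Real.sqrt (2 * (2 * D + 1) * (1 + 8 * (L + D + 1) / ((β ^ 2 / 8) ^ 4 * (β * (N' - 2 * D)))) /
            ((β ^ 2 / 8) ^ 4 * (β * (N' - 2 * D))))) ∧
    1 + 4 * (Real.sqrt N' + 1) / 3 *
          (2 * Real.sqrt 192 * Real.sqrt (2 * (2 * D + 1) * (1 + 8 * (L + D + 1) / ((β ^ 2 / 8) ^ 4 * (β * (N' - 2 * D)))) /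
            ((β ^ 2 / 8) ^ 4 * (β * (N' - 2 * D))))) ≤
      (1 + 8 * (2 * Real.sqrt 192 * Real.sqrt (80 / ((β ^ 2 / 8) ^ 4 * β))) / 3) * P ∧
    0 ≤ 4 * ((1 + 8 * (L + D + 1) / ((β ^ 2 / 8) ^ 4 * (β * (N' - 2 * D)))) *
          (8 * (L + D + 1) / ((β ^ 2 / 8) ^ 4 * (β * (N' - 2 * D))) +
            2 * Real.sqrt 192 * Real.sqrt (2 * (2 * D + 1) * (1 + 8 * (L + D + 1) / ((β ^ 2 / 8) ^ 4 * (β * (N' - 2 * D)))) /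
            ((β ^ 2 / 8) ^ 4 * (β * (N' - 2 * D)))))) ^ 2 / (3 * β) ∧
    4 * ((1 + 8 * (L + D + 1) / ((β ^ 2 / 8) ^ 4 * (β * (N' - 2 * D)))) *
          (8 * (L + D + 1) / ((β ^ 2 / 8) ^ 4 * (β * (N' - 2 * D))) +
            2 * Real.sqrt 192 * Real.sqrt (2 * (2 * D + 1) * (1 + 8 * (L + D + 1) / ((β ^ 2 / 8) ^ 4 * (β * (N' - 2 * D)))) /
            ((β ^ 2 / 8) ^ 4 * (β * (N' - 2 * D)))))) ^ 2 / (3 * β) ≤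
      16 * (32 * cL / ((β ^ 2 / 8) ^ 4 * β) + 2 * Real.sqrt 192 * Real.sqrt (80 / ((β ^ 2 / 8) ^ 4 * β))) ^ 2 / (3 * β) / P ^ 6 := by
  -- abbreviations
  obtain ⟨cη, hcη⟩ : ∃ c : ℝ, c = 32 * cL / ((β ^ 2 / 8) ^ 4 * β) := ⟨_, rfl⟩
  obtain ⟨cQ, hcQ⟩ : ∃ c : ℝ, c = 2 * Real.sqrt 192 * Real.sqrt (80 / ((β ^ 2 / 8) ^ 4 * β)) := ⟨_, rfl⟩
  obtain ⟨ηx, hηx⟩ : ∃ e : ℝ, e = 8 * (L + D + 1) / ((β ^ 2 / 8) ^ 4 * (β * (N' - 2 * D))) := ⟨_, rfl⟩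
  rw [← hcη] at hPη ⊢
  rw [← hηx, ← hcQ]
  obtain ⟨Qx, hQx⟩ : ∃ e : ℝ, e = 2 * Real.sqrt 192 * Real.sqrt (2 * (2 * D + 1) * (1 + ηx) / ((β ^ 2 / 8) ^ 4 * (β * (N' - 2 * D)))) :=
    ⟨_, rfl⟩
  rw [← hQx]
  -- positivity of the scale
  have hP0 : 0 < P := by linarith only [hP1]
  have hP3pos : 0 < P ^ 3 := by positivity
  have hP8 : 1 ≤ P ^ 8 := one_le_pow₀ hP1
  have hN'pos : 0 < N' - 2 * D := lt_of_lt_of_le (by positivity) hN'lo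
  have hN'0 : 0 ≤ N' := by linarith only [hN'pos, hD0]
  have hb0 : 0 < (β ^ 2 / 8) ^ 4 * β := by positivity
  have hdenpos : 0 < (β ^ 2 / 8) ^ 4 * (β * (N' - 2 * D)) := by positivity
  have hden : (β ^ 2 / 8) ^ 4 * β * (P ^ 8 / 4) ≤ (β ^ 2 / 8) ^ 4 * (β * (N' - 2 * D)) := by
    have := mul_le_mul_of_nonneg_left hN'lo hb0.le
    linarith only [this]
  have hcη0 : 0 ≤ cη := by rw [hcη]; positivity
  have hcQ0 : 0 ≤ cQ := by rw [hcQ]; positivity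
  have hLD1' : 0 ≤ L + D + 1 := by linarith only [hL0, hD0]
  have hηx0 : 0 ≤ ηx := by rw [hηx]; positivity
  -- `η ≤ c_η / P³ ≤ 1`
  have hηs : ηx ≤ cη / P ^ 3 := by
    rw [hηx, div_le_div_iff₀ hdenpos hP3pos, hcη]
    have h1 : 8 * (L + D + 1) * P ^ 3 ≤ 8 * (cL * P ^ 5) * P ^ 3 :=
      mul_le_mul_of_nonneg_right (by linarith only [hLD1]) hP3pos.le
    have h2 : 32 * cL / ((β ^ 2 / 8) ^ 4 * β) * ((β ^ 2 / 8) ^ 4 * β * (P ^ 8 / 4)) = 8 * (cL * P ^ 5) * P ^ 3 := by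
      field_simp; ring
    calc 8 * (L + D + 1) * P ^ 3 ≤ 8 * (cL * P ^ 5) * P ^ 3 := h1
      _ = 32 * cL / ((β ^ 2 / 8) ^ 4 * β) * ((β ^ 2 / 8) ^ 4 * β * (P ^ 8 / 4)) := h2.symm
      _ ≤ 32 * cL / ((β ^ 2 / 8) ^ 4 * β) * ((β ^ 2 / 8) ^ 4 * (β * (N' - 2 * D))) :=
          mul_le_mul_of_nonneg_left hden (by positivity)
  have hη1 : ηx ≤ 1 := hηs.trans (by rw [div_le_one hP3pos]; exact hPη)
  -- `Q ≤ c_Q / P³`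
  have hQs : Qx ≤ cQ / P ^ 3 := by
    have harg : 2 * (2 * D + 1) * (1 + ηx) / ((β ^ 2 / 8) ^ 4 * (β * (N' - 2 * D))) ≤ 80 / ((β ^ 2 / 8) ^ 4 * β) * (1 / P ^ 3) ^ 2 := by
      have hnum : 2 * (2 * D + 1) * (1 + ηx) ≤ 2 * (5 * P ^ 2) * 2 := by
        have hq1 : 2 * D + 1 ≤ 5 * P ^ 2 := by
          have : (1 : ℝ) ≤ P ^ 2 := one_le_pow₀ hP1
          linarith only [hD, this]
        exact mul_le_mul (by linarith only [hq1]) (by linarith only [hη1]) (by positivity) (by positivity)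
      calc _ ≤ 2 * (5 * P ^ 2) * 2 / ((β ^ 2 / 8) ^ 4 * (β * (N' - 2 * D))) := div_le_div_of_nonneg_right hnum hdenpos.le
        _ ≤ 2 * (5 * P ^ 2) * 2 / ((β ^ 2 / 8) ^ 4 * β * (P ^ 8 / 4)) :=
            div_le_div_of_nonneg_left (by positivity) (by positivity) hden
        _ = 80 / ((β ^ 2 / 8) ^ 4 * β) * (1 / P ^ 3) ^ 2 := by field_simp; ring
    have hs : Real.sqrt (2 * (2 * D + 1) * (1 + ηx) / ((β ^ 2 / 8) ^ 4 * (β * (N' - 2 * D)))) ≤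
        Real.sqrt (80 / ((β ^ 2 / 8) ^ 4 * β)) / P ^ 3 := by
      calc Real.sqrt _ ≤ Real.sqrt (80 / ((β ^ 2 / 8) ^ 4 * β) * (1 / P ^ 3) ^ 2) := Real.sqrt_le_sqrt harg
        _ = Real.sqrt (80 / ((β ^ 2 / 8) ^ 4 * β)) * (1 / P ^ 3) := by
            rw [Real.sqrt_mul (by positivity), Real.sqrt_sq (by positivity)]
        _ = Real.sqrt (80 / ((β ^ 2 / 8) ^ 4 * β)) / P ^ 3 := by ring
    calc Qx = 2 * Real.sqrt 192 * Real.sqrt (2 * (2 * D + 1) * (1 + ηx) / ((β ^ 2 / 8) ^ 4 * (β * (N' - 2 * D)))) := hQx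
      _ ≤ 2 * Real.sqrt 192 * (Real.sqrt (80 / ((β ^ 2 / 8) ^ 4 * β)) / P ^ 3) := mul_le_mul_of_nonneg_left hs (by positivity)
      _ = cQ / P ^ 3 := by rw [hcQ]; ring
  have hQs0 : 0 ≤ Qx := by rw [hQx]; positivity
  -- `Γ`
  have hsqrtN : Real.sqrt N' ≤ P ^ 4 := by
    rw [show P ^ 4 = Real.sqrt ((P ^ 4) ^ 2) by rw [Real.sqrt_sq (by positivity)]]
    exact Real.sqrt_le_sqrt (by nlinarith only [hN'hi])
  have hΓ : 1 + 4 * (Real.sqrt N' + 1) / 3 * Qx ≤ (1 + 8 * cQ / 3) * P := by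
    have hq1 : 4 * (Real.sqrt N' + 1) / 3 ≤ 8 * P ^ 4 / 3 := by
      have : (1 : ℝ) ≤ P ^ 4 := one_le_pow₀ hP1
      linarith only [this, hsqrtN]
    have hq2 : 4 * (Real.sqrt N' + 1) / 3 * Qx ≤ (8 * P ^ 4 / 3) * (cQ / P ^ 3) := mul_le_mul hq1 hQs hQs0 (by positivity)
    have hq3 : (8 * P ^ 4 / 3) * (cQ / P ^ 3) = (8 * cQ / 3) * P := by field_simp
    rw [hq3] at hq2
    linarith only [hq2, hP1]
  have hΓ1 : 1 ≤ 1 + 4 * (Real.sqrt N' + 1) / 3 * Qx := le_add_of_nonneg_right (by positivity)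
  -- `ρ` and `q`
  have hρ : (1 + ηx) * (ηx + Qx) ≤ 2 * ((cη + cQ) / P ^ 3) := by
    have hq1 : ηx + Qx ≤ (cη + cQ) / P ^ 3 := by rw [add_div]; exact add_le_add hηs hQs
    exact mul_le_mul (by linarith only [hη1]) hq1 (by positivity) (by norm_num)
  have hρ0 : 0 ≤ (1 + ηx) * (ηx + Qx) := by positivity
  have hq : 4 * ((1 + ηx) * (ηx + Qx)) ^ 2 / (3 * β) ≤ 16 * (cη + cQ) ^ 2 / (3 * β) / P ^ 6 := by
    have hq1 : ((1 + ηx) * (ηx + Qx)) ^ 2 ≤ (2 * ((cη + cQ) / P ^ 3)) ^ 2 := pow_le_pow_left₀ hρ0 hρ 2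
    have e : 16 * (cη + cQ) ^ 2 / (3 * β) / P ^ 6 = 4 * (2 * ((cη + cQ) / P ^ 3)) ^ 2 / (3 * β) := by
      field_simp; ring
    rw [e]
    exact div_le_div_of_nonneg_right (mul_le_mul_of_nonneg_left hq1 (by norm_num)) (by positivity)
  exact ⟨hηs, hQs, hΓ1, hΓ, by positivity, hq⟩

/-- **The product `Γ(N′)·q(N′)` is `O(P⁻⁵)`**: under the hypotheses of `lqConstants_le`,
`Γ(N′)·q(N′) ≤ (1 + 8c_Q/3)·(16(c_η+c_Q)²/(3β))/P⁵`. The main terms of brick 137's `ε_B` (`m·Γq/√cV` with `m ≤ P⁸`, `√cV ≍ P⁴`) and of `ε_C` (`2Γq`)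
are therefore `O(P⁻¹)` and `O(P⁻⁵)`. [cite: RollinRoss2010, §4.1 Thm 4.2 (the variance scale)] -/
theorem Gamma_mul_q_le {β P D L N' cL : ℝ} (hβ : 0 < β) (hP1 : 1 ≤ P) (hD0 : 0 ≤ D) (hD : D ≤ 2 * P ^ 2)
    (hL0 : 0 ≤ L) (hcL : 0 ≤ cL) (hLD1 : L + D + 1 ≤ cL * P ^ 5) (hN'lo : P ^ 8 / 4 ≤ N' - 2 * D) (hN'hi : N' ≤ P ^ 8)
    (hPη : 32 * cL / ((β ^ 2 / 8) ^ 4 * β) ≤ P ^ 3) :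
    (1 + 4 * (Real.sqrt N' + 1) / 3 *
          (2 * Real.sqrt 192 * Real.sqrt (2 * (2 * D + 1) * (1 + 8 * (L + D + 1) / ((β ^ 2 / 8) ^ 4 * (β * (N' - 2 * D)))) /
            ((β ^ 2 / 8) ^ 4 * (β * (N' - 2 * D)))))) *
      (4 * ((1 + 8 * (L + D + 1) / ((β ^ 2 / 8) ^ 4 * (β * (N' - 2 * D)))) *
          (8 * (L + D + 1) / ((β ^ 2 / 8) ^ 4 * (β * (N' - 2 * D))) +
            2 * Real.sqrt 192 * Real.sqrt (2 * (2 * D + 1) * (1 + 8 * (L + D + 1) / ((β ^ 2 / 8) ^ 4 * (β * (N' - 2 * D)))) /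
            ((β ^ 2 / 8) ^ 4 * (β * (N' - 2 * D)))))) ^ 2 / (3 * β)) ≤
      (1 + 8 * (2 * Real.sqrt 192 * Real.sqrt (80 / ((β ^ 2 / 8) ^ 4 * β))) / 3) *
        (16 * (32 * cL / ((β ^ 2 / 8) ^ 4 * β) + 2 * Real.sqrt 192 * Real.sqrt (80 / ((β ^ 2 / 8) ^ 4 * β))) ^ 2 / (3 * β)) / P ^ 5 := by
  obtain ⟨-, -, hΓ1, hΓ, hq0, hq⟩ := lqConstants_le hβ hP1 hD0 hD hL0 hcL hLD1 hN'lo hN'hi hPη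
  have hP0 : 0 < P := by linarith only [hP1]
  have hK0 : 0 ≤ (1 + 8 * (2 * Real.sqrt 192 * Real.sqrt (80 / ((β ^ 2 / 8) ^ 4 * β))) / 3) := by positivity
  have hK1 : 0 ≤ 16 * (32 * cL / ((β ^ 2 / 8) ^ 4 * β) + 2 * Real.sqrt 192 * Real.sqrt (80 / ((β ^ 2 / 8) ^ 4 * β))) ^ 2 / (3 * β) := by
    positivity
  calc _ ≤ ((1 + 8 * (2 * Real.sqrt 192 * Real.sqrt (80 / ((β ^ 2 / 8) ^ 4 * β))) / 3) * P) *
        (16 * (32 * cL / ((β ^ 2 / 8) ^ 4 * β) + 2 * Real.sqrt 192 * Real.sqrt (80 / ((β ^ 2 / 8) ^ 4 * β))) ^ 2 / (3 * β) / P ^ 6) :=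
        mul_le_mul hΓ hq hq0 (by positivity)
    _ = _ := by field_simp

/-- **The far term is monotone in the edge number**: `e^{−(L−2D)²/(4N′)} ≤ e^{−(L−2D)²/(4N)}` for `0 < N′ ≤ N` (the pinned families `N′ = N₀−1, N₀−2`
inherit brick 124a's far-term budget at `N₀`). [cite: Agarwal2000DifferenceEquations, Remark 1.8.1] -/
theorem exp_far_mono {L D N' N : ℝ} (hN' : 0 < N') (hN'N : N' ≤ N) :
    Real.exp (-((L - 2 * D) ^ 2 / (4 * N'))) ≤ Real.exp (-((L - 2 * D) ^ 2 / (4 * N))) := by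
  rw [Real.exp_le_exp, neg_le_neg_iff]
  exact div_le_div_of_nonneg_left (sq_nonneg _) (by positivity) (by linarith)

end Summit.PneNP.PneNP.Theorems.ChebyshevTracialDesignLqConstantsScale

end
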